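import Summits.BirchSwinnertonDyer.Rank1Residual.Additive.XGordRankZeroOneCyclotomicThreeLower
import Summits.BirchSwinnertonDyer.Rank1Residual.Additive.XGordRankZeroOneCyclotomicThreeFacts
import Summits.BirchSwinnertonDyer.Rank1Residual.Additive.GordRankZeroChiBranch
import Summits.BirchSwinnertonDyer.Rank1Residual.Additive.TypeGThree
import Summits.BirchSwinnertonDyer.Rank1Residual.Partition.HeadlineNoLemma20
import HarnessLib

/-!
# The LOWER twin of line V17 (X4, `p = 3`, ranks `(0,1)`, over `K = ℚ(ζ₃)`) from named facts + the ONE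
# residual input (⊇/K): `Typed.MissingLowerBoundAt W 3` and `BSD(W,3)` on the (G-ord, `e = 2`)@3 rows with
# `surj(3) ∧ ram(3)`, `r_an(W) = 0`, twist of analytic rank ONE — anomalous rows included
# (cell `b2b-bsdres`, team n1011, seat p16, OWNERS row T-N11-GK3LOW)

HONEST FRAMING (cell `b2b-bsdres`, run/shared/lean/b2b/bsd-rank1-residual/, verbatim in every
file): the goal of the cell is to DELETE the COMBINATION-SHAPED residual classes of the
Birch–Swinnerton-Dyer formula for ALL analytic-rank `≤ 1` elliptic curves over `ℚ` — "full BSD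
formula for every rank `≤ 1` curve in class `C`" assembled STRICTLY from published theorems — so
that the rank-`≤ 1` remainder becomes exactly the CONSTRUCTION-SHAPED classes, which are TYPED
(missing-input `Prop`s), NOT attempted. This is not "finishing BSD". Team n1011 (N10 / N11), seat
p16: research route; the labels of X4 / X10 and the N10 / N11 marks are UNCHANGED by this file;
nothing is booked here (the referee rules on bookings).

Theorems only (no `def`, no `sorry`, no new named fact). Companion of
`XGordRankZeroOneCyclotomicThreeLower.lean` (core theorem; mathematics in its module docstring) and the
ranks-`(0,1)` sequel of `XGordRankZeroCyclotomicThreeLowerFacts.lean` (ranks `(0,0)`), with IDENTICAL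
structure: `K = CyclotomicField 3 ℚ`; the inline hypotheses of the core theorem are discharged from NAMED
FACTS exactly as additive-p4 did for the UPPER line V17 (`XGordRankZeroOneCyclotomicThreeFacts.lean`) —
`hTorK` from Kato 2004 Thm. 17.4 (3) over `K` (torsion clause; image from `surj(3) ∧ ram(3)` of `W`),
`hS1K` from Greenberg p. 110 over number fields (`Greenberg1999.schneider_charCoeff_rankOne_quadraticBaseChange`,
K-shape `XGordRankZeroOneCyclotomicThree.schneiderK_of_fact`), THE canonical `3`-adic height from the
Mazur–Tate sigma function (`hMT`), Perrin-Riou (`hPR`), Milne (`hMilne`), the newform / periods from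
`hmodD`; per row the CERTIFICATE `[T¹]L₃(f_V,α) ≠ 0` (`hcert`, as in V17). What is NOT discharged — the
section hypothesis `hLowK` of every theorem below — is the ONE residual input

  (⊇/K)  every `g ∈ char_Λ X(V/K_∞)` is `ι h · ϖϖ' · L₃(V,ω⁰,T) · L₃(V,ω¹,T)` for some `h ∈ Λ = ℤ₃⟦T⟧`
         (for every newform / period normalisation `(f, ϖ, ϖ')` of `V`),

the two-branch main-conjecture CONTAINMENT for `V` over `ℚ(√−3)` = PLAN §1.2 II.3's wall at `p = 3`
(the binder list of the Kato fact with its divisibility REVERSED; NOT in print; no `def`, no fact).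

## Results (`V` good ordinary at `3`, `r_an(V) = 1`; `W = C • V^{(−3)}` additive at `3`, `r_an(W) = 0`)

* `XGordRankZeroOneCyclotomicThreeLower.exists_padicVal_shaAn_add_le_of_surj_of_ram` —
  **`ord₃ #Ш_an(V) + ord₃ #Ш_an(W) ≤ ord₃ #Ш(V) + ord₃ #Ш(W)`** from (⊇/K) + named facts + `hcert`;
* `…padicVal_shaOrder_add_eq_of_surj_of_ram` — with line V17 (Kato ⊆ over `K`): EQUALITY of the sums;
* `…missingLowerBoundAt_of_missingUpperBoundAt_twist_of_surj_of_ram` — `Typed.MissingLowerBoundAt W 3`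
  ⟸ (⊇/K) + the UPPER half of the rank-one twist `V`;
* `…bsdp_iff_bsdp_twist_of_surj_of_ram` — **`BSD(W,3) ↔ BSD(V,3)`** under the two-sided main conjecture
  over `K` (the additive rank-`0` pair and its good ordinary rank-ONE twist pair);
* `…bsdp_of_surj_of_ram` — **`BSD(W,3)`** (and `BSD(V,3)`) ⟸ (⊇/K) + named facts + `hcert`, using for
  the rank-one good ordinary twist the tree theorem `bsdp_three_of_goodOrd_of_surj_noL20` (Yan–Zhu 2026
  Thm. 4.15 [PUB\*, flag `YZ26@3-BF-ERL-Ohta`], analytic rank `≤ 1`; seat p02);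
* class forms on N11's (G-ord)@3 rows: `ClassX4Gord.missingLowerBoundAt_three_rankZero_twistRankOne_of_lowerK_of_surj_of_ram`,
  `ClassX4Gord.bsdp_three_rankZero_twistRankOne_of_lowerK_of_surj_of_ram`.

WHY (OWNERS row T-N11-GK3LOW): with the ranks-`(0,0)` file, the `K`-route now gives the LOWER half on
EVERY X4 ∧ (G-ord, `e = 2`)@3 ∧ `surj ∧ ram` row of analytic rank `0` whose twist `E♭` has analytic rank
`≤ 1` — anomalous rows included, no `ℓ ∣ 9` slack, no `ExactLeadingTermAt` — modulo (⊇/K) (and, in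
twist-rank one, the finite certificate `hcert`). Twist-rank `≥ 2` is out of reach of every `ℚ(ζ₃)`-line.
Nothing booked; labels unchanged.
-/

noncomputable section

open scoped Classical MatrixGroups ModularForm

open CongruenceSubgroup WeierstrassCurve NumberField IsDedekindDomain
  Literature.NumberTheory.EllipticCurves Literature.NumberTheory.EllipticCurves.ModularForms
  Literature.NumberTheory.EllipticCurves.Rank1Residual
  Literature.NumberTheory.EllipticCurves.Rank1Residual.Typed
  Literature.NumberTheory.GaloisRepresentations

namespace Summit.BirchSwinnertonDyer.Rank1Residual.Additive

section Facts

variable (V : WeierstrassCurve ℚ) [V.IsElliptic] [V.IsGloballyMinimal]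
  (W : WeierstrassCurve ℚ) [W.IsElliptic] [W.IsGloballyMinimal]

/- The ONE residual input (⊇/K) for `V` over `K = CyclotomicField 3 ℚ` (module docstring); a section
hypothesis shared by every theorem of this section. -/
variable
    (hLowK : ∀ {κ : ZpExtension (CyclotomicField 3 ℚ) 3}
      {γ : Field.absoluteGaloisGroup (CyclotomicField 3 ℚ)} {N : ℕ} [NeZero N]
      {f : CuspForm (Gamma0 N) 2},
      κ.IsCyclotomic → κ.IsTopGenerator γ →
      (∃ ζ : ℤ_[3]ˣ, IsOfFinOrder ζ ∧
        ((GaloisRep.cyclotomicCharacter (CyclotomicField 3 ℚ) 3 γ * ζ : ℤ_[3]ˣ) : ℤ_[3]) =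
          (cyclotomicGenerator 3 : ℤ_[3])) →
      IsNewformOf V f →
      ∀ (D : (V.baseChange (CyclotomicField 3 ℚ)).SelmerDualData κ γ) (ϖ ϖ' : ℚ),
        (ϖ : ℝ) * V.realPeriodRat = plusPeriod f →
        (ϖ' : ℝ) * V.imaginaryPeriodRat = minusPeriod f →
        ∀ g ∈ D.charIdeal, ∃ h : IwasawaAlgebra 3,
          iwasawaToPowerSeries 3 g =
            iwasawaToPowerSeries 3 h *
              (PowerSeries.C ((ϖ : ℚ_[3]) * (ϖ' : ℚ_[3])) *
                (padicLFunction f ((unitRoot V 3 : ℤ_[3]) : ℚ_[3]) *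
                  padicLFunctionMinusBranch f ((unitRoot V 3 : ℤ_[3]) : ℚ_[3]) 1)))

include hLowK

/-- **LOWER twin of line V17 for X4, from named facts + (⊇/K) + the certificate.** For `V/ℚ` globally
minimal, good ordinary at `3`, of analytic rank `1`, `W = C • V^{(−3)}` globally minimal ADDITIVE at `3` of
analytic rank `0` with `surj(3) ∧ ram(3)` (so `ρ_{V,3^∞}` is onto, `forall_surj_pow_of_twist_pStar_of_surj_of_ram`),
and the certificate `[T¹]L₃(f,α) ≠ 0` for the newform(s) of `V`: `#Ш_an(V) = q_V`, `#Ш_an(W) = q_W` with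
**`ord₃ q_V + ord₃ q_W ≤ ord₃ #Ш(V) + ord₃ #Ш(W)`**, granted (⊇/K) (`hLowK`) and EXACTLY the named facts
of line V17: Kato Thm. 17.4 (3) over `ℚ(ζ₃)` (`hKato`, torsion clause), Greenberg p. 110 / Schneider over
`ℚ(ζ₃)` (`hS1`), Perrin-Riou 1987 (`hPR`), the Mazur–Tate sigma function (`hMT`), Milne 1972 (`hMilne`),
modularity (`hmod`, `hmodD`), GZK (`hGZK`). [cite: GreenbergLNM1716, §4 p. 110]
[cite: PerrinRiou1987, §1.4 Cor. 1.8] [cite: Kato2004Asterisque, Thm. 17.4 (3) (p. 273)]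
[cite: Milne1972ArithmeticAV, §1 Thm. 1] -/
theorem XGordRankZeroOneCyclotomicThreeLower.exists_padicVal_shaAn_add_le_of_surj_of_ram
    (hKato : Kato2004.charIdeal_dvd_padicLFunction_cyclotomicThree_of_surjective)
    (hS1 : Greenberg1999.schneider_charCoeff_rankOne_quadraticBaseChange)
    (hPR : perrinRiou_rankOne_leadingTerms_odd) (hMT : mazur_tate_sigma_exists_odd)
    (hMilne : Milne1972.bsdQuotient_baseChange_quadratic_anyModel)
    (hGZK : rank_eq_analyticRank_of_analyticRank_le_one) (hmod : hasEntireLFunction_rat)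
    (hmodD : nonempty_modularParametrizationData)
    (C : VariableChange ℚ) (hC : C • V.quadraticTwist (-(3 : ℚ)) = W)
    (hord : IsOrdinaryAt V 3) (hsurj : Surj W 3) (hram : Ram W 3) (hadd : Addv W 3)
    (hrV : V.analyticRank = 1) (hrW : W.analyticRank = 0)
    (hcert : ∀ {N : ℕ} [NeZero N] (f : CuspForm (Gamma0 N) 2), IsNewformOf V f →
      PowerSeries.coeff 1 (padicLFunction f ((unitRoot V 3 : ℤ_[3]) : ℚ_[3])) ≠ 0) :
    ∃ qV qW : ℚ, shaAn V = (qV : ℂ) ∧ shaAn W = (qW : ℂ) ∧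
      padicValRat 3 qV + padicValRat 3 qW ≤ (padicValNat 3 V.shaOrder : ℤ) + padicValNat 3 W.shaOrder := by
  haveI : IsCyclotomicExtension {3} ℚ (CyclotomicField 3 ℚ) := CyclotomicField.isCyclotomicExtension 3 ℚ
  set K := CyclotomicField 3 ℚ
  haveI : NeZero (V.conductorNorm ℤ) := ⟨(V.conductorNorm_pos_holds).ne'⟩
  obtain ⟨Dm⟩ := hmodD V
  have hf : IsNewformOf V Dm.f := Dm.isNewformOf
  obtain ⟨ϖ, -, hϖ, -⟩ := Dm.exists_rat_mul_realPeriodRat_eq_plusPeriod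
  obtain ⟨ϖ', -, hϖ'⟩ := exists_rat_mul_imaginaryPeriodRat_eq_minusPeriod Dm
  obtain ⟨Dh, hDh⟩ := exists_isCanonical_of_odd hMT V 3 (by norm_num) hord.1 hord.2
  have hC' : C • V.quadraticTwist (((-((3 : ℕ) : ℤ)) : ℤ) : ℚ) = W := by push_cast; exact hC
  have hsurjV : ∀ n : ℕ, V.HasSurjectiveModNGaloisRep (3 ^ n : ℕ) :=
    forall_surj_pow_of_twist_pStar_of_surj_of_ram 3 V (k := -1) (by norm_num) (Or.inr rfl) C hC' hsurj hram
  haveI : (V.baseChange K).IsElliptic := by rw [baseChange]; infer_instance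
  refine XGordRankZeroOneCyclotomicThreeLower.exists_padicVal_shaAn_add_le K V W hPR hGZK hmod hMilne C hC
    hord hadd hrV hrW hf ϖ ϖ' hϖ hϖ' Dh hDh (hcert Dm.f hf) (fun κ γ hκ hγ hγ' D ↦ ?_)
    (fun κ γ hκ hγ hγ' D g hg ↦ hLowK hκ hγ hγ' hf D ϖ ϖ' hϖ hϖ' g hg)
    (XGordRankZeroOneCyclotomicThree.schneiderK_of_fact K V hS1 hord)
  exact (hKato V K (V.baseChange K) hord hsurjV ⟨1, one_smul _ _⟩ hκ hγ hγ' hf D ϖ ϖ' hϖ hϖ').1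

/-- **The two-sided main conjecture over `K` gives the EQUALITY of sums in ranks `(0,1)`.** The UPPER
line V17 (`X4GordRankZeroOneCyclotomicThree.exists_padicVal_shaOrder_add_le_of_surj_of_ram`, Kato ⊆ over
`K`, a THEOREM modulo named facts + `hcert`) and the LOWER twin (⊇/K) together:
**`ord₃ #Ш(V) + ord₃ #Ш(W) = ord₃ #Ш_an(V) + ord₃ #Ш_an(W)`**.
[cite: Kato2004Asterisque, Thm. 17.4 (3) (p. 273)] [cite: GreenbergLNM1716, §4 p. 110] -/
theorem XGordRankZeroOneCyclotomicThreeLower.padicVal_shaOrder_add_eq_of_surj_of_ram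
    (hKato : Kato2004.charIdeal_dvd_padicLFunction_cyclotomicThree_of_surjective)
    (hS1 : Greenberg1999.schneider_charCoeff_rankOne_quadraticBaseChange)
    (hPR : perrinRiou_rankOne_leadingTerms_odd) (hMT : mazur_tate_sigma_exists_odd)
    (hMilne : Milne1972.bsdQuotient_baseChange_quadratic_anyModel)
    (hGZK : rank_eq_analyticRank_of_analyticRank_le_one) (hmod : hasEntireLFunction_rat)
    (hmodD : nonempty_modularParametrizationData)
    (C : VariableChange ℚ) (hC : C • V.quadraticTwist (-(3 : ℚ)) = W)
    (hord : IsOrdinaryAt V 3) (hsurj : Surj W 3) (hram : Ram W 3) (hadd : Addv W 3)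
    (hrV : V.analyticRank = 1) (hrW : W.analyticRank = 0)
    (hcert : ∀ {N : ℕ} [NeZero N] (f : CuspForm (Gamma0 N) 2), IsNewformOf V f →
      PowerSeries.coeff 1 (padicLFunction f ((unitRoot V 3 : ℤ_[3]) : ℚ_[3])) ≠ 0) :
    ∃ qV qW : ℚ, shaAn V = (qV : ℂ) ∧ shaAn W = (qW : ℂ) ∧
      (padicValNat 3 V.shaOrder : ℤ) + padicValNat 3 W.shaOrder = padicValRat 3 qV + padicValRat 3 qW := by
  obtain ⟨qV, qW, hqV, hqW, hle⟩ :=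
    X4GordRankZeroOneCyclotomicThree.exists_padicVal_shaOrder_add_le_of_surj_of_ram V W hKato hS1 hPR hMT
      hMilne hGZK hmod hmodD C hC hord hsurj hram hadd hrV hrW hcert
  obtain ⟨qV', qW', hqV', hqW', hge⟩ :=
    XGordRankZeroOneCyclotomicThreeLower.exists_padicVal_shaAn_add_le_of_surj_of_ram V W hLowK hKato hS1 hPR hMT hMilne hGZK hmod hmodD C hC hord hsurj hram hadd hrV hrW hcert
  have hqq : qV' = qV := by exact_mod_cast hqV'.symm.trans hqV
  have hqq' : qW' = qW := by exact_mod_cast hqW'.symm.trans hqW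
  subst hqq hqq'
  exact ⟨qV', qW', hqV, hqW, le_antisymm hle hge⟩

/-- **`Typed.MissingLowerBoundAt W 3` for the ADDITIVE rank-`0` curve from (⊇/K) and the UPPER half of its
good ordinary rank-ONE twist** (X4 ∧ (G-ord, `e = 2`)@3 ∧ `surj ∧ ram`, anomalous rows included).
[cite: GreenbergLNM1716, §4 p. 110] [cite: Miller2011LMS, Def. 1.1] -/
theorem XGordRankZeroOneCyclotomicThreeLower.missingLowerBoundAt_of_missingUpperBoundAt_twist_of_surj_of_ram
    (hKato : Kato2004.charIdeal_dvd_padicLFunction_cyclotomicThree_of_surjective)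
    (hS1 : Greenberg1999.schneider_charCoeff_rankOne_quadraticBaseChange)
    (hPR : perrinRiou_rankOne_leadingTerms_odd) (hMT : mazur_tate_sigma_exists_odd)
    (hMilne : Milne1972.bsdQuotient_baseChange_quadratic_anyModel)
    (hGZK : rank_eq_analyticRank_of_analyticRank_le_one) (hmod : hasEntireLFunction_rat)
    (hmodD : nonempty_modularParametrizationData)
    (C : VariableChange ℚ) (hC : C • V.quadraticTwist (-(3 : ℚ)) = W)
    (hord : IsOrdinaryAt V 3) (hsurj : Surj W 3) (hram : Ram W 3) (hadd : Addv W 3)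
    (hrV : V.analyticRank = 1) (hrW : W.analyticRank = 0)
    (hcert : ∀ {N : ℕ} [NeZero N] (f : CuspForm (Gamma0 N) 2), IsNewformOf V f →
      PowerSeries.coeff 1 (padicLFunction f ((unitRoot V 3 : ℤ_[3]) : ℚ_[3])) ≠ 0)
    (huV : MissingUpperBoundAt V 3) : MissingLowerBoundAt W 3 := by
  obtain ⟨qV, qW, hqV, hqW, hge⟩ :=
    XGordRankZeroOneCyclotomicThreeLower.exists_padicVal_shaAn_add_le_of_surj_of_ram V W hLowK hKato hS1 hPR hMT hMilne hGZK hmod hmodD C hC hord hsurj hram hadd hrV hrW hcert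
  obtain ⟨qV', hqV', hu⟩ := huV
  have hqq : qV' = qV := by exact_mod_cast hqV'.symm.trans hqV
  subst hqq
  exact ⟨qW, hqW, by linarith⟩

/-- **Symmetrically: `Typed.MissingLowerBoundAt V 3` for the rank-ONE good ordinary curve `V` from (⊇/K)
and the UPPER half of its additive rank-`0` twist `W`.** [cite: GreenbergLNM1716, §4 p. 110]
[cite: Miller2011LMS, Def. 1.1] -/
theorem XGordRankZeroOneCyclotomicThreeLower.missingLowerBoundAt_twist_of_missingUpperBoundAt_of_surj_of_ram
    (hKato : Kato2004.charIdeal_dvd_padicLFunction_cyclotomicThree_of_surjective)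
    (hS1 : Greenberg1999.schneider_charCoeff_rankOne_quadraticBaseChange)
    (hPR : perrinRiou_rankOne_leadingTerms_odd) (hMT : mazur_tate_sigma_exists_odd)
    (hMilne : Milne1972.bsdQuotient_baseChange_quadratic_anyModel)
    (hGZK : rank_eq_analyticRank_of_analyticRank_le_one) (hmod : hasEntireLFunction_rat)
    (hmodD : nonempty_modularParametrizationData)
    (C : VariableChange ℚ) (hC : C • V.quadraticTwist (-(3 : ℚ)) = W)
    (hord : IsOrdinaryAt V 3) (hsurj : Surj W 3) (hram : Ram W 3) (hadd : Addv W 3)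
    (hrV : V.analyticRank = 1) (hrW : W.analyticRank = 0)
    (hcert : ∀ {N : ℕ} [NeZero N] (f : CuspForm (Gamma0 N) 2), IsNewformOf V f →
      PowerSeries.coeff 1 (padicLFunction f ((unitRoot V 3 : ℤ_[3]) : ℚ_[3])) ≠ 0)
    (huW : MissingUpperBoundAt W 3) : MissingLowerBoundAt V 3 := by
  obtain ⟨qV, qW, hqV, hqW, hge⟩ :=
    XGordRankZeroOneCyclotomicThreeLower.exists_padicVal_shaAn_add_le_of_surj_of_ram V W hLowK hKato hS1 hPR hMT hMilne hGZK hmod hmodD C hC hord hsurj hram hadd hrV hrW hcert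
  obtain ⟨qW', hqW', hu⟩ := huW
  have hqq : qW' = qW := by exact_mod_cast hqW'.symm.trans hqW
  subst hqq
  exact ⟨qV, hqV, by linarith⟩

/-- **Λ-adic twist transport at `3`, ranks `(0,1)`: `BSD(W,3) ↔ BSD(V,3)` under the two-sided main
conjecture over `K = ℚ(ζ₃)`** — the BSD defects of the additive rank-`0` curve `W` and of its good
ordinary rank-ONE twist `V` are opposite (`…padicVal_shaOrder_add_eq_of_surj_of_ram`), so one vanishes
iff the other does. [cite: Kato2004Asterisque, Thm. 17.4 (3) (p. 273)] [cite: Miller2011LMS, §1 and Def. 1.1] -/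
theorem XGordRankZeroOneCyclotomicThreeLower.bsdp_iff_bsdp_twist_of_surj_of_ram
    (hKato : Kato2004.charIdeal_dvd_padicLFunction_cyclotomicThree_of_surjective)
    (hS1 : Greenberg1999.schneider_charCoeff_rankOne_quadraticBaseChange)
    (hPR : perrinRiou_rankOne_leadingTerms_odd) (hMT : mazur_tate_sigma_exists_odd)
    (hMilne : Milne1972.bsdQuotient_baseChange_quadratic_anyModel)
    (hGZK : rank_eq_analyticRank_of_analyticRank_le_one) (hmod : hasEntireLFunction_rat)
    (hmodD : nonempty_modularParametrizationData)
    (C : VariableChange ℚ) (hC : C • V.quadraticTwist (-(3 : ℚ)) = W)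
    (hord : IsOrdinaryAt V 3) (hsurj : Surj W 3) (hram : Ram W 3) (hadd : Addv W 3)
    (hrV : V.analyticRank = 1) (hrW : W.analyticRank = 0)
    (hcert : ∀ {N : ℕ} [NeZero N] (f : CuspForm (Gamma0 N) 2), IsNewformOf V f →
      PowerSeries.coeff 1 (padicLFunction f ((unitRoot V 3 : ℤ_[3]) : ℚ_[3])) ≠ 0) :
    BSDp W 3 ↔ BSDp V 3 := by
  obtain ⟨qV, qW, hqV, hqW, heq⟩ :=
    XGordRankZeroOneCyclotomicThreeLower.padicVal_shaOrder_add_eq_of_surj_of_ram V W hLowK hKato hS1 hPR hMT hMilne hGZK hmod hmodD C hC hord hsurj hram hadd hrV hrW hcert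
  have hrV1 : V.analyticRank ≤ 1 := by rw [hrV]
  have hrW1 : W.analyticRank ≤ 1 := by rw [hrW]; exact zero_le_one
  haveI : Finite V.sha := (hGZK V hrV1).2
  haveI : Finite W.sha := (hGZK W hrW1).2
  constructor
  · intro hW
    obtain ⟨qW', hqW', hvW⟩ := missingPPartAt_of_bsdp W 3 hW
    have hqq : qW' = qW := by exact_mod_cast hqW'.symm.trans hqW
    subst hqq
    exact bsdp_of_missingPPartAt V 3 hGZK hrV1 ⟨qV, hqV, by linarith⟩
  · intro hV
    obtain ⟨qV', hqV', hvV⟩ := missingPPartAt_of_bsdp V 3 hV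
    have hqq : qV' = qV := by exact_mod_cast hqV'.symm.trans hqV
    subst hqq
    exact bsdp_of_missingPPartAt W 3 hGZK hrW1 ⟨qW, hqW, by linarith⟩

/-- **`BSD(W,3)` (and `BSD(V,3)`) on X4 ∧ (G-ord, `e = 2`) ∧ `p = 3` ∧ `r_an(W) = 0` ∧ twist of analytic
rank ONE ∧ `surj ∧ ram` — anomalous rows included — from (⊇/K), the certificate and named facts only.**
`BSD(V,3)` for the rank-one good ordinary twist with `ρ̄_{V,3}` onto (`surj_iff_of_model_twist`) is the
tree theorem `bsdp_three_of_goodOrd_of_surj_noL20` (Yan–Zhu 2026 Thm. 4.15 [PUB\*] `hYZ`, modularity,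
GZK); the twist transport carries it to the additive curve. X4 label UNCHANGED; nothing booked.
[cite: YanZhu2024MainConjNonCM, Thm. 4.15 (§4.6)] [cite: Kato2004Asterisque, Thm. 17.4 (3) (p. 273)]
[cite: GreenbergLNM1716, §4 p. 110] [cite: Milne1972ArithmeticAV, §1 Thm. 1] -/
theorem XGordRankZeroOneCyclotomicThreeLower.bsdp_of_surj_of_ram
    (hYZ : YanZhu2026.thm415_padicValRat_bsd_rank_le_one)
    (hKato : Kato2004.charIdeal_dvd_padicLFunction_cyclotomicThree_of_surjective)
    (hS1 : Greenberg1999.schneider_charCoeff_rankOne_quadraticBaseChange)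
    (hPR : perrinRiou_rankOne_leadingTerms_odd) (hMT : mazur_tate_sigma_exists_odd)
    (hMilne : Milne1972.bsdQuotient_baseChange_quadratic_anyModel)
    (hGZK : rank_eq_analyticRank_of_analyticRank_le_one) (hmod : hasEntireLFunction_rat)
    (hmodD : nonempty_modularParametrizationData)
    (C : VariableChange ℚ) (hC : C • V.quadraticTwist (-(3 : ℚ)) = W)
    (hord : IsOrdinaryAt V 3) (hsurj : Surj W 3) (hram : Ram W 3) (hadd : Addv W 3)
    (hrV : V.analyticRank = 1) (hrW : W.analyticRank = 0)
    (hcert : ∀ {N : ℕ} [NeZero N] (f : CuspForm (Gamma0 N) 2), IsNewformOf V f →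
      PowerSeries.coeff 1 (padicLFunction f ((unitRoot V 3 : ℤ_[3]) : ℚ_[3])) ≠ 0) :
    BSDp W 3 ∧ BSDp V 3 := by
  have hsurjV : Surj V 3 := (surj_iff_of_model_twist V 3 (by norm_num : (-(3 : ℚ)) ≠ 0) ⟨C, hC⟩).mp hsurj
  have hV : BSDp V 3 :=
    bsdp_three_of_goodOrd_of_surj_noL20 hYZ hmod hGZK (by rw [hrV]) hord hsurjV
  exact ⟨(XGordRankZeroOneCyclotomicThreeLower.bsdp_iff_bsdp_twist_of_surj_of_ram V W hLowK hKato hS1 hPR hMT hMilne hGZK hmod hmodD C hC hord hsurj hram hadd hrV hrW hcert).mpr hV,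
    hV⟩

end Facts

/-! ## Class forms on N11's (G-ord)@3 rows (`ClassX4Gord W 3`, twist of analytic rank one) -/

section ClassForms

variable {W : WeierstrassCurve ℚ} [W.IsElliptic] [W.IsGloballyMinimal]

/- (⊇/K) for every good-ordinary twist model `V` of `W^{(−3)}` — the per-row residual input of the class
forms, shared by the theorems of this section. -/
variable
    (hLowK : ∀ (V : WeierstrassCurve ℚ) [V.IsElliptic] [V.IsGloballyMinimal] (C : VariableChange ℚ),
      GoodOrd V 3 → C • V.quadraticTwist (-(3 : ℚ)) = W →
      ∀ {κ : ZpExtension (CyclotomicField 3 ℚ) 3}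
      {γ : Field.absoluteGaloisGroup (CyclotomicField 3 ℚ)} {N : ℕ} [NeZero N]
      {f : CuspForm (Gamma0 N) 2},
      κ.IsCyclotomic → κ.IsTopGenerator γ →
      (∃ ζ : ℤ_[3]ˣ, IsOfFinOrder ζ ∧
        ((GaloisRep.cyclotomicCharacter (CyclotomicField 3 ℚ) 3 γ * ζ : ℤ_[3]ˣ) : ℤ_[3]) =
          (cyclotomicGenerator 3 : ℤ_[3])) →
      IsNewformOf V f →
      ∀ (D : (V.baseChange (CyclotomicField 3 ℚ)).SelmerDualData κ γ) (ϖ ϖ' : ℚ),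
        (ϖ : ℝ) * V.realPeriodRat = plusPeriod f →
        (ϖ' : ℝ) * V.imaginaryPeriodRat = minusPeriod f →
        ∀ g ∈ D.charIdeal, ∃ h : IwasawaAlgebra 3,
          iwasawaToPowerSeries 3 g =
            iwasawaToPowerSeries 3 h *
              (PowerSeries.C ((ϖ : ℚ_[3]) * (ϖ' : ℚ_[3])) *
                (padicLFunction f ((unitRoot V 3 : ℤ_[3]) : ℚ_[3]) *
                  padicLFunctionMinusBranch f ((unitRoot V 3 : ℤ_[3]) : ℚ_[3]) 1)))

include hLowK

/-- **X4♯(G-ord) at `3` ∧ `surj ∧ ram`, `r_an(E) = 0`, twist of analytic rank ONE, EVERY ROW (anomalous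
included): the LOWER half `ord₃ #Ш_an(E) ≤ ord₃ #Ш(E)` ⟸ (⊇/K) for the good ordinary twist models of
`E^{(−3)}` + their certificates `[T¹]L₃ ≠ 0` + their UPPER halves** (per-row binders over all globally
minimal `V`, `C` with `GoodOrd V 3`, `C • V^{(−3)} = E`; a model exists by
`ClassX4Gord.exists_goodOrd_pStar_twist_model`, `e = 2` by `semistabilityIndex_eq_two_of_typeG_three`).
[cite: GreenbergLNM1716, §4 p. 110] [cite: Miller2011LMS, Def. 1.1] -/
theorem ClassX4Gord.missingLowerBoundAt_three_rankZero_twistRankOne_of_lowerK_of_surj_of_ram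
    [Fact (Nat.Prime 3)]
    (hKato : Kato2004.charIdeal_dvd_padicLFunction_cyclotomicThree_of_surjective)
    (hS1 : Greenberg1999.schneider_charCoeff_rankOne_quadraticBaseChange)
    (hPR : perrinRiou_rankOne_leadingTerms_odd) (hMT : mazur_tate_sigma_exists_odd)
    (hMilne : Milne1972.bsdQuotient_baseChange_quadratic_anyModel)
    (hGZK : rank_eq_analyticRank_of_analyticRank_le_one) (hmod : hasEntireLFunction_rat)
    (hmodD : nonempty_modularParametrizationData)
    (hX : ClassX4Gord W 3) (hsurj : Surj W 3) (hram : Ram W 3) (hr : W.analyticRank = 0)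
    (hrV : ∀ (V : WeierstrassCurve ℚ) [V.IsElliptic] [V.IsGloballyMinimal] (C : VariableChange ℚ),
      GoodOrd V 3 → C • V.quadraticTwist (-(3 : ℚ)) = W → V.analyticRank = 1)
    (hcert : ∀ (V : WeierstrassCurve ℚ) [V.IsElliptic] [V.IsGloballyMinimal] (C : VariableChange ℚ),
      GoodOrd V 3 → C • V.quadraticTwist (-(3 : ℚ)) = W →
      ∀ {N : ℕ} [NeZero N] (f : CuspForm (Gamma0 N) 2), IsNewformOf V f →
      PowerSeries.coeff 1 (padicLFunction f ((unitRoot V 3 : ℤ_[3]) : ℚ_[3])) ≠ 0)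
    (huV : ∀ (V : WeierstrassCurve ℚ) [V.IsElliptic] [V.IsGloballyMinimal] (C : VariableChange ℚ),
      GoodOrd V 3 → C • V.quadraticTwist (-(3 : ℚ)) = W → MissingUpperBoundAt V 3) :
    MissingLowerBoundAt W 3 := by
  obtain ⟨V, iV, iVm, C, hgo, hC⟩ := ClassX4Gord.exists_goodOrd_pStar_twist_model W 3 hX
    (semistabilityIndex_eq_two_of_typeG_three W hX.typeGOrd.typeG hX.addv.2)
  have hC' : C • V.quadraticTwist (-(3 : ℚ)) = W := by
    have h3 : ((-1 : ℚ) ^ ((3 : ℕ) / 2) * (3 : ℕ)) = -(3 : ℚ) := by norm_num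
    rw [← h3]; exact hC
  exact XGordRankZeroOneCyclotomicThreeLower.missingLowerBoundAt_of_missingUpperBoundAt_twist_of_surj_of_ram
    V W (fun hκ hγ hγ' hf D ϖ ϖ' hϖ hϖ' g hg ↦ hLowK V C hgo hC' hκ hγ hγ' hf D ϖ ϖ' hϖ hϖ' g hg)
    hKato hS1 hPR hMT hMilne hGZK hmod hmodD C hC' hgo hsurj hram hX.addv.2 (hrV V C hgo hC') hr
    (hcert V C hgo hC') (huV V C hgo hC')

/-- **X4♯(G-ord) at `3` ∧ `surj ∧ ram`, `r_an(E) = 0`, twist of analytic rank ONE, EVERY ROW (anomalous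
included): `BSD(E,3)` ⟸ (⊇/K) for the good ordinary twist models of `E^{(−3)}` + their certificates** and
the named facts Yan–Zhu 2026 Thm. 4.15 (`hYZ`, for the rank-one twist), Kato Thm. 17.4 (3) over `K`,
Greenberg p. 110 / Schneider, Perrin-Riou, Mazur–Tate, Milne, modularity, GZK. The one non-fact,
non-certificate input is (⊇/K) = PLAN §1.2 II.3's wall at `p = 3`; X4♯(G-ord) stays CONSTRUCTION-SHAPED;
nothing booked. [cite: YanZhu2024MainConjNonCM, Thm. 4.15 (§4.6)] [cite: GreenbergLNM1716, §4 p. 110]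
[cite: Kato2004Asterisque, Thm. 17.4 (3) (p. 273)] [cite: Milne1972ArithmeticAV, §1 Thm. 1] -/
theorem ClassX4Gord.bsdp_three_rankZero_twistRankOne_of_lowerK_of_surj_of_ram [Fact (Nat.Prime 3)]
    (hYZ : YanZhu2026.thm415_padicValRat_bsd_rank_le_one)
    (hKato : Kato2004.charIdeal_dvd_padicLFunction_cyclotomicThree_of_surjective)
    (hS1 : Greenberg1999.schneider_charCoeff_rankOne_quadraticBaseChange)
    (hPR : perrinRiou_rankOne_leadingTerms_odd) (hMT : mazur_tate_sigma_exists_odd)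
    (hMilne : Milne1972.bsdQuotient_baseChange_quadratic_anyModel)
    (hGZK : rank_eq_analyticRank_of_analyticRank_le_one) (hmod : hasEntireLFunction_rat)
    (hmodD : nonempty_modularParametrizationData)
    (hX : ClassX4Gord W 3) (hsurj : Surj W 3) (hram : Ram W 3) (hr : W.analyticRank = 0)
    (hrV : ∀ (V : WeierstrassCurve ℚ) [V.IsElliptic] [V.IsGloballyMinimal] (C : VariableChange ℚ),
      GoodOrd V 3 → C • V.quadraticTwist (-(3 : ℚ)) = W → V.analyticRank = 1)
    (hcert : ∀ (V : WeierstrassCurve ℚ) [V.IsElliptic] [V.IsGloballyMinimal] (C : VariableChange ℚ),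
      GoodOrd V 3 → C • V.quadraticTwist (-(3 : ℚ)) = W →
      ∀ {N : ℕ} [NeZero N] (f : CuspForm (Gamma0 N) 2), IsNewformOf V f →
      PowerSeries.coeff 1 (padicLFunction f ((unitRoot V 3 : ℤ_[3]) : ℚ_[3])) ≠ 0) :
    BSDp W 3 := by
  obtain ⟨V, iV, iVm, C, hgo, hC⟩ := ClassX4Gord.exists_goodOrd_pStar_twist_model W 3 hX
    (semistabilityIndex_eq_two_of_typeG_three W hX.typeGOrd.typeG hX.addv.2)
  have hC' : C • V.quadraticTwist (-(3 : ℚ)) = W := by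
    have h3 : ((-1 : ℚ) ^ ((3 : ℕ) / 2) * (3 : ℕ)) = -(3 : ℚ) := by norm_num
    rw [← h3]; exact hC
  exact (XGordRankZeroOneCyclotomicThreeLower.bsdp_of_surj_of_ram V W
    (fun hκ hγ hγ' hf D ϖ ϖ' hϖ hϖ' g hg ↦ hLowK V C hgo hC' hκ hγ hγ' hf D ϖ ϖ' hϖ hϖ' g hg)
    hYZ hKato hS1 hPR hMT hMilne hGZK hmod hmodD C hC' hgo hsurj hram hX.addv.2 (hrV V C hgo hC') hr
    (hcert V C hgo hC')).1

end ClassForms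

end Summit.BirchSwinnertonDyer.Rank1Residual.Additive

end
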